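import Summits.QuantumFields.YangMills.Theorems.BalabanUVNodesN12RootedForest
import Summits.QuantumFields.YangMills.Theorems.BalabanUVNodesN12FlatChartDerivIterLin
import Summits.QuantumFields.YangMills.Theorems.BalabanUVNodesN12GuardedLinAvgRightInverse
import Summits.QuantumFields.YangMills.Theorems.BalabanUVNodesN12GuardedChartDerivIterLin
import HarnessLib

/-!
# BalabanUVNodes ∕ N12 — THE ONTO HALF FOR THE FOREST SLICE AT NODE 00's FLAT CHART: `DΦ(0)` kills every residual pure gauge `dξ` (`ξ` constant along the constrained bonds at the centres —
# in particular `ξ = 0` on the constrained representatives `R(𝐁, k)`), so by the residual decomposition `V = S_forest + T_res` of `N12RootedForest` the surjectivity of `DΦ(0)` on the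
# whole space (dag-n10-w1's WAY (ii)) is surjectivity FROM THE FOREST SLICE, and a linear right inverse valued in the slice exists ([15] (45) for the tree gauge)

Cell `pub-ymgap` (HUMAN RULINGS D-0062 ∕ D-0149), WIDTH SEAT `pub-ymgap-dag-n12-w3` g3 (node N12 = [B15]; key K1⁸ `stmt-QuantumFields-26907`, `--kind proof --supports … --as helper`;
count-neutral).  THEOREMS ONLY (0 `def`, 0 `instance`, 0 `sorry`); consumed BY NAME: this seat's `N12RootedForest.exists_residual_of_forest` ∕ `forest_F1`, dag-n10-w1's
`N12FlatChartDerivIterLin.fderiv_msChart_one_apply_eq_iterLin` (p600194), `N12GuardedLinAvgRightInverse.exists_rightInverse_fderiv_msChart_of_flat_letter` ∕ `exists_letter_of_linear`,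
`N12GuardedChartDerivQLinJunction.fderiv_msChart_apply_eq_suProj_qLin`, `N12GuardedChartDerivIterLin.exists_stokesThreshold` ∕ `plaqSmall_iter_one`, the route UnitScaleTilt's
`Prop7AvgLinearisation.iterLin_grad`; Mathlib's `LinearMap.exists_rightInverse_of_surjective`.

WHY.  dag-n12-w1's per-base-field letter `hH` ([Balaban1985Variational] (45): a right inverse of the linearised multi-scale averaging FROM THE SLICE) and dag-n12-w4's `hsurj` are, for
the forest slice of `N12RootedForest` ∕ `N12ForestSlice`, one line away from surjectivity on the whole space: every field is a slice field minus a residual pure gauge `dξ` with `ξ = 0` on the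
roots (`exists_residual_of_forest`), and the linearised constraint `DΦ(0)` — whose `i`-th component is the projected linearised average `Q^{(j)}↑X(c)` at the `i`-th constrained bond
(`fderiv_msChart_one_apply_eq_iterLin`) — kills `dξ` as soon as `ξ` takes equal values at the centres of the two ends of every constrained bond (`iterLin_grad`: `Q^{(j)}(dξ)(c) =
ξ(embIter j c₊) − ξ(embIter j c₋)`), in particular when `ξ` vanishes on `R(𝐁, k)`.  The residual decomposition is used at the FLAT
base only (at a curved base the residual directions are the `Ad`-twisted gradients); the slice-valued right inverse nevertheless PERSISTS to every guarded near-flat base, because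
dag-n10-w1's perturbation composes inside the range of the flat one (§1, last theorem).

CONTENTS.  §1 ★ `fderiv_msChart_one_grad_eq_zero_of_locConst` (`DΦ(0)(dξ) = 0` for `ξ` constant along the constrained bonds at the centres; any `𝐁`), ★★ `exists_forest_preimage_of_surjective`
(surjective on `V` ⟹ every target value is hit FROM THE FOREST SLICE; any rooted forest with (F1) and roots ⊇ `R(𝐁, k)`), ★★ `exists_forest_rightInverse_of_surjective` (a LINEAR right inverse of
`DΦ(0)` valued in the forest slice), ★★★ `exists_forest_rightInverse_nearFlat_of_surjective` (the slice-valued right inverse PERSISTS to every guarded near-flat base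
`U₀`, `‖↑U₀ − 1‖ < ρ′`: dag-n10-w1's `exists_rightInverse_fderiv_msChart_of_flat_letter` composes `H₁ ∘ G` INSIDE the range of the flat `H₁`).  §2 the record: ★★ `exists_forest_rightInverse_Bj_of_surjective` (with `N12RootedForest.exists_rootedForest_Bj`'s forest: `∃ path H`, (F1) ∧ (F2) ∧ (TREE) ∧
`H` slice-valued ∧ `DΦ(0) ∘ H = id`).

HONEST FRAMING.  Flat configuration only; linear algebra and bookkeeping; the surjectivity of `DΦ(0)` on the whole space is DISPLAYED (dag-n10-w1's WAY (ii) lineage supplies it at the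
record); no constants; nothing of Bałaban's estimates asserted; N12 NOT discharged; K1⁸ NOT closed; counts unmoved (typed 28∕28 · discharged 5∕27); one finite 𝕋⁴ programme at fixed ε —
R4 closes the conditional rung `BalabanLadder.UV` only; the Yang–Mills mass gap (Clay) is NOT proved by any of this; nothing continuum ∕ ℝ⁴ ∕ OS.
-/

noncomputable section

namespace Summit.QuantumFields.YangMills.BalabanUVNodes.N12ForestOnto

open scoped BigOperators Matrix.Norms.L2Operator Topology
open Literature.MathematicalPhysics.QuantumFieldTheory.Balaban1983to89
open T4Continuum
open B15DeterminingSets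
open BlockAveragingEMLLinearised (linAvg)
open T4AdjointCovarianceUnitary (lieSU)
open ExpMeanLog (deltaSU)
open Node00
open Summit.QuantumFields.YangMills.Theorems.Prop7AvgLinearisation (iterLin_grad)
open Summit.QuantumFields.YangMills.BalabanUVNodes.N12FlatChartDerivIterLin (fderiv_msChart_one_apply_eq_iterLin)
open Summit.QuantumFields.YangMills.BalabanUVNodes.N12RootedForest (exists_residual_of_forest forest_F1 exists_rootedForest_Bj)
open Summit.QuantumFields.YangMills.Theorems.BlockAvgCorrector (stokesConst)
open Summit.QuantumFields.YangMills.BalabanUVNodes.N12GuardedChartDerivQLinJunction (fderiv_msChart_apply_eq_suProj_qLin)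
open Summit.QuantumFields.YangMills.BalabanUVNodes.N12GuardedLinAvgRightInverse (exists_letter_of_linear exists_rightInverse_fderiv_msChart_of_flat_letter)
open Summit.QuantumFields.YangMills.BalabanUVNodes.N12GuardedChartDerivIterLin (exists_stokesThreshold plaqSmall_iter_one)

variable {F : T4Family} {N : ℕ} [NeZero N] {K k : ℕ}

/-! ## §1 `DΦ(0)` kills the residual pure gauges; surjectivity from the forest slice -/

/-- ★ **`DΦ(0)(dξ) = 0` FOR A LOCALLY-CONSTANT `ξ`**: if `ξ` takes equal values at the centres of the two ends of every constrained bond of `𝐁` (levels `≤ k`; in particular if `ξ = 0` on the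
constrained representatives `R(𝐁, k)` — the residual gauge group (4)), then the pure gauge `dξ` lies in the kernel of the linearised multi-scale constraint at NODE 00's flat chart
(`Q^{(j)}(dξ)(c) = ξ(embIter j c₊) − ξ(embIter j c₋)`). [cite: Balaban1985Variational, (4) p.278, (44)–(48) p.285; Balaban1988Convergent, (2.10)–(2.12) p.256] -/
theorem fderiv_msChart_one_grad_eq_zero_of_locConst (𝔹 : DetSet (F.P K)) (ξ : Site (F.P K) 0 → lieSU (Fin N))
    (hξ : ∀ j, j ≤ k → ∀ c ∈ bondsOf (𝔹 j), ξ (embIter j c.tgt) = ξ (embIter j c.src)) :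
    fderiv ℝ (msChart F N K k 𝔹 (avgFamily (avOfRecord F N K) (1 : GaugeField (F.P K) 0 (SU N))) (1 : GaugeField (F.P K) 0 (SU N))) 0
      (fun b : PBond (F.P K) 0 => ξ b.tgt - ξ b.src) = 0 := by
  obtain ⟨Q, hQ0, hQs⟩ : ∃ Q : (i : ℕ) → (PBond (F.P K) 0 → Matrix (Fin N) (Fin N) ℂ) → PBond (F.P K) i → Matrix (Fin N) (Fin N) ℂ,
      (∀ Y, Q 0 Y = Y) ∧ ∀ (i : ℕ) (Y : PBond (F.P K) 0 → Matrix (Fin N) (Fin N) ℂ) (c : PBond (F.P K) (i + 1)), Q (i + 1) Y c = linAvg (Q i Y) c :=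
    ⟨fun i => Nat.rec (motive := fun i => (PBond (F.P K) 0 → Matrix (Fin N) (Fin N) ℂ) → PBond (F.P K) i → Matrix (Fin N) (Fin N) ℂ) (fun Y => Y)
      (fun _ Qi Y c => linAvg (Qi Y) c) i, fun _ => rfl, fun _ _ _ => rfl⟩
  funext i
  rw [fderiv_msChart_one_apply_eq_iterLin Q hQ0 hQs 𝔹 _ i, Pi.zero_apply]
  set jc := (constrEnum 𝔹 k).symm i
  have hj : jc.1.val ≤ k := Nat.le_of_lt_succ jc.1.isLt
  have hc : jc.2.1 ∈ bondsOf (𝔹 jc.1.val) := jc.2.2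
  have hgrad : Q jc.1.val (fun b : PBond (F.P K) 0 => ((ξ b.tgt - ξ b.src : lieSU (Fin N)) : Matrix (Fin N) (Fin N) ℂ)) jc.2.1
      = (ξ (embIter jc.1.val jc.2.1.tgt) : Matrix (Fin N) (Fin N) ℂ) - (ξ (embIter jc.1.val jc.2.1.src) : Matrix (Fin N) (Fin N) ℂ) := by
    have h := iterLin_grad Q hQ0 hQs (fun i ψ w => ψ (embIter i w)) (fun ψ => rfl) (fun i ψ w => rfl) (fun x => (ξ x : Matrix (Fin N) (Fin N) ℂ)) jc.1.val jc.2.1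
    simpa only [Submodule.coe_sub] using h
  rw [hgrad, hξ _ hj _ hc, sub_self]
  simp

/-- ★★ **SURJECTIVITY FROM THE FOREST SLICE**: if `DΦ(0)` is onto on the whole space of fine `𝔰𝔲(N)`-fields, then every target value is attained by a field VANISHING ON EVERY PATH BOND of any rooted
forest with (F1) whose roots contain the constrained representatives `R(𝐁, k)` — by the residual decomposition `X₀ = X − dξ`, `ξ|_R = 0`, of `N12RootedForest.exists_residual_of_forest` and §1.
[cite: Balaban1985Variational, (4) p.278, (16)–(18) p.280, (45) p.285; Balaban1985RegularSpaces, (1.19) p.79] -/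
theorem exists_forest_preimage_of_surjective (𝔹 : DetSet (F.P K))
    {path : Site (F.P K) 0 → List (LStep (F.P K) 0)}
    (hroot : ∀ r ∈ {z : Site (F.P K) 0 | ∃ j, j ≤ k ∧ ∃ c ∈ bondsOf (𝔹 j), (z = embIter j c.src ∨ z = embIter j c.tgt)}, path r = [])
    (hF1 : ∀ x, ∀ s ∈ path x, ∃ x' x'' : Site (F.P K) 0, path x'' = path x' ++ [s] ∧
      (s.fwd = true → s.bond.src = x' ∧ s.bond.tgt = x'') ∧ (s.fwd = false → s.bond.src = x'' ∧ s.bond.tgt = x'))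
    (hsurj : Function.Surjective
      (fderiv ℝ (msChart F N K k 𝔹 (avgFamily (avOfRecord F N K) (1 : GaugeField (F.P K) 0 (SU N))) (1 : GaugeField (F.P K) 0 (SU N))) 0))
    (τ : Fin (constrCard 𝔹 k) → lieSU (Fin N)) :
    ∃ X : PBond (F.P K) 0 → lieSU (Fin N), (∀ x, ∀ s ∈ path x, X s.bond = 0) ∧
      fderiv ℝ (msChart F N K k 𝔹 (avgFamily (avOfRecord F N K) (1 : GaugeField (F.P K) 0 (SU N))) (1 : GaugeField (F.P K) 0 (SU N))) 0 X = τ := by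
  obtain ⟨X₀, hX₀⟩ := hsurj τ
  obtain ⟨ξ, hξR, hξ⟩ := exists_residual_of_forest hroot hF1 X₀
  refine ⟨fun b => X₀ b + (ξ b.tgt - ξ b.src), fun x s hs => hξ x s hs, ?_⟩
  have hadd : (fun b : PBond (F.P K) 0 => X₀ b + (ξ b.tgt - ξ b.src)) = X₀ + fun b => ξ b.tgt - ξ b.src := rfl
  rw [hadd, map_add, hX₀, fderiv_msChart_one_grad_eq_zero_of_locConst 𝔹 ξ fun j hj c hc => ?_, add_zero]
  rw [hξR _ ⟨j, hj, c, hc, Or.inr rfl⟩, hξR _ ⟨j, hj, c, hc, Or.inl rfl⟩]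

/-- ★★ **A LINEAR RIGHT INVERSE OF `DΦ(0)` VALUED IN THE FOREST SLICE** ([Balaban1985Variational] (45) for the tree gauge, flat base field): from surjectivity on the whole space and a rooted
forest with (F1), roots ⊇ `R(𝐁, k)`. [cite: Balaban1985Variational, (45) p.285, (4) p.278; Balaban1985RegularSpaces, (1.19) p.79] -/
theorem exists_forest_rightInverse_of_surjective (𝔹 : DetSet (F.P K))
    {path : Site (F.P K) 0 → List (LStep (F.P K) 0)}
    (hroot : ∀ r ∈ {z : Site (F.P K) 0 | ∃ j, j ≤ k ∧ ∃ c ∈ bondsOf (𝔹 j), (z = embIter j c.src ∨ z = embIter j c.tgt)}, path r = [])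
    (hF1 : ∀ x, ∀ s ∈ path x, ∃ x' x'' : Site (F.P K) 0, path x'' = path x' ++ [s] ∧
      (s.fwd = true → s.bond.src = x' ∧ s.bond.tgt = x'') ∧ (s.fwd = false → s.bond.src = x'' ∧ s.bond.tgt = x'))
    (hsurj : Function.Surjective
      (fderiv ℝ (msChart F N K k 𝔹 (avgFamily (avOfRecord F N K) (1 : GaugeField (F.P K) 0 (SU N))) (1 : GaugeField (F.P K) 0 (SU N))) 0)) :
    ∃ H : (Fin (constrCard 𝔹 k) → lieSU (Fin N)) →ₗ[ℝ] (PBond (F.P K) 0 → lieSU (Fin N)),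
      (∀ τ, ∀ x, ∀ s ∈ path x, H τ s.bond = 0) ∧
      ∀ τ, fderiv ℝ (msChart F N K k 𝔹 (avgFamily (avOfRecord F N K) (1 : GaugeField (F.P K) 0 (SU N))) (1 : GaugeField (F.P K) 0 (SU N))) 0 (H τ) = τ := by
  -- the forest slice as a real submodule
  let S : Submodule ℝ (PBond (F.P K) 0 → lieSU (Fin N)) :=
    { carrier := {X | ∀ x, ∀ s ∈ path x, X s.bond = 0}
      add_mem' := fun {X Y} hX hY x s hs => by simp only [Pi.add_apply, hX x s hs, hY x s hs, add_zero]
      zero_mem' := fun _ _ _ => rfl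
      smul_mem' := fun c X hX x s hs => by simp only [Pi.smul_apply, hX x s hs, smul_zero] }
  set D := fderiv ℝ (msChart F N K k 𝔹 (avgFamily (avOfRecord F N K) (1 : GaugeField (F.P K) 0 (SU N))) (1 : GaugeField (F.P K) 0 (SU N))) 0 with hD
  have hrange : LinearMap.range ((D : (PBond (F.P K) 0 → lieSU (Fin N)) →ₗ[ℝ] (Fin (constrCard 𝔹 k) → lieSU (Fin N))) ∘ₗ S.subtype) = ⊤ := by
    refine LinearMap.range_eq_top.2 fun τ => ?_
    obtain ⟨X, hXS, hX⟩ := exists_forest_preimage_of_surjective 𝔹 hroot hF1 hsurj τ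
    exact ⟨⟨X, hXS⟩, hX⟩
  obtain ⟨g, hg⟩ := LinearMap.exists_rightInverse_of_surjective _ hrange
  refine ⟨S.subtype ∘ₗ g, fun τ => (g τ).2, fun τ => ?_⟩
  have h := LinearMap.congr_fun hg τ
  simpa only [LinearMap.comp_apply, LinearMap.id_apply, ContinuousLinearMap.coe_coe] using h

/-- ★★★ **THE SLICE-VALUED RIGHT INVERSE PERSISTS TO EVERY GUARDED NEAR-FLAT BASE**: from surjectivity of `DΦ(0)` at the FLAT chart and a rooted forest with (F1), roots ⊇ `R(𝐁, k)`, one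
radius `ρ′ > 0` such that at every configuration `U₀` whose iterated averages below `k` are `t₀`-small (`stokesConst·t₀ < δ_N`) and with `‖↑U₀ − 1‖ < ρ′`, the linearised constraint
`DΦ_{U₀}(0)` of NODE 00's chart with its own datum `M˙(U₀)` has a LINEAR right inverse VALUED IN THE FOREST SLICE — dag-n10-w1's `exists_rightInverse_fderiv_msChart_of_flat_letter` composes
`H₁ ∘ G` inside the range of the flat slice-valued `H₁` of `exists_forest_rightInverse_of_surjective` (the flat right-inverse property is moved to the `qLin` currency by
`fderiv_msChart_apply_eq_suProj_qLin` at `U = 1`, guard by `plaqSmall_iter_one`). [cite: Balaban1985Variational, (45)–(48) p.285, (4) p.278; Balaban1985Averaging, Prop. 3 p.36; Balaban1985RegularSpaces, (1.19) p.79] -/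
theorem exists_forest_rightInverse_nearFlat_of_surjective (𝔹 : DetSet (F.P K))
    {path : Site (F.P K) 0 → List (LStep (F.P K) 0)}
    (hroot : ∀ r ∈ {z : Site (F.P K) 0 | ∃ j, j ≤ k ∧ ∃ c ∈ bondsOf (𝔹 j), (z = embIter j c.src ∨ z = embIter j c.tgt)}, path r = [])
    (hF1 : ∀ x, ∀ s ∈ path x, ∃ x' x'' : Site (F.P K) 0, path x'' = path x' ++ [s] ∧
      (s.fwd = true → s.bond.src = x' ∧ s.bond.tgt = x'') ∧ (s.fwd = false → s.bond.src = x'' ∧ s.bond.tgt = x'))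
    (hsurj : Function.Surjective
      (fderiv ℝ (msChart F N K k 𝔹 (avgFamily (avOfRecord F N K) (1 : GaugeField (F.P K) 0 (SU N))) (1 : GaugeField (F.P K) 0 (SU N))) 0)) :
    ∃ ρ' : ℝ, 0 < ρ' ∧ ∀ ⦃t₀ : ℝ⦄, 0 < t₀ → stokesConst (F.P K) * t₀ < deltaSU (Fin N) →
      ∀ U₀ : GaugeField (F.P K) 0 (SU N), (∀ i, i < k → PlaqSmall t₀ (Averaging.iter (avOfRecord F N K) i U₀)) → ‖coeField U₀ - 1‖ < ρ' →
        ∃ H : (Fin (constrCard 𝔹 k) → lieSU (Fin N)) →ₗ[ℝ] (PBond (F.P K) 0 → lieSU (Fin N)),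
          (∀ τ, ∀ x, ∀ s ∈ path x, H τ s.bond = 0) ∧
          ∀ τ, fderiv ℝ (msChart F N K k 𝔹 (avgFamily (avOfRecord F N K) U₀) U₀) 0 (H τ) = τ := by
  obtain ⟨H₁, hS, hH₁⟩ := exists_forest_rightInverse_of_surjective 𝔹 hroot hF1 hsurj
  obtain ⟨t₁, ht₁, hst₁⟩ := exists_stokesThreshold (P := F.P K) (N := N)
  have h₁ : ∀ y i, suProj N (qLin (((constrEnum 𝔹 k).symm i).1 : ℕ) (1 : GaugeField (F.P K) 0 (SU N)) (H₁ y) ((constrEnum 𝔹 k).symm i).2.1) = y i := by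
    intro y i
    rw [← fderiv_msChart_apply_eq_suProj_qLin ht₁ hst₁ (fun i _ => plaqSmall_iter_one ht₁ i) 𝔹 (H₁ y) i]
    exact congrFun (hH₁ y) i
  obtain ⟨B, hB0, hB⟩ := exists_letter_of_linear H₁
  obtain ⟨ρ', hρ', h⟩ := exists_rightInverse_fderiv_msChart_of_flat_letter 𝔹 H₁ h₁ hB0 hB
  refine ⟨ρ', hρ', fun t₀ ht₀ hst U₀ hsm hU => ?_⟩
  obtain ⟨G, hG, -, -⟩ := h ht₀ hst U₀ hsm hU
  exact ⟨H₁ ∘ₗ G, fun τ => hS (G τ), fun τ => by rw [LinearMap.comp_apply]; exact hG τ⟩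

/-! ## §2 At the record's `𝐁_k(Z)` -/

section Record

open Literature.MathematicalPhysics.QuantumFieldTheory.Balaban1983to89.B14.Eq213DetSet (Bj)
open Literature.MathematicalPhysics.QuantumFieldTheory.Balaban1983to89.B14.Eq213MaximalDomains (side)

variable {M₁ : ℕ} {Z : Set (Site (F.P K) 0)}

/-- ★★ **THE FOREST RIGHT INVERSE AT THE RECORD**: for `𝐁_k(Z)` (every `Z`), the rooted forest of `N12RootedForest.exists_rootedForest_Bj` ((F1), (F2), (TREE)) together with a LINEAR right inverse
of `DΦ(0)` valued in its slice — given surjectivity on the whole space (dag-n10-w1's WAY (ii), DISPLAYED).  The same `path` serves the (β)♭ letters of `N12ForestSlice` and the criticality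
transfer of `B15Prop1AxialGaugeSectionOfForest`. [cite: Balaban1985Variational, (45) p.285, (4) p.278, (16)–(18) p.280; Balaban1988Convergent, (2.2) p.255, (2.13) pp.256–257] -/
theorem exists_forest_rightInverse_Bj_of_surjective (hk : k ≤ (F.P K).m + (F.P K).K) (hk1 : 1 ≤ k) (hM : 1 ≤ M₁)
    (hdiv : side (F.P K).L M₁ k ∣ (F.P K).sitesPerDir 0)
    (hsurj : Function.Surjective
      (fderiv ℝ (msChart F N K k (Bj M₁ Z k) (avgFamily (avOfRecord F N K) (1 : GaugeField (F.P K) 0 (SU N))) (1 : GaugeField (F.P K) 0 (SU N))) 0)) :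
    ∃ (path : Site (F.P K) 0 → List (LStep (F.P K) 0)) (H : (Fin (constrCard (Bj M₁ Z k : DetSet (F.P K)) k) → lieSU (Fin N)) →ₗ[ℝ] (PBond (F.P K) 0 → lieSU (Fin N))),
      (∀ x, ∀ s ∈ path x, ∃ x' x'' : Site (F.P K) 0, path x'' = path x' ++ [s] ∧
        (s.fwd = true → s.bond.src = x' ∧ s.bond.tgt = x'') ∧ (s.fwd = false → s.bond.src = x'' ∧ s.bond.tgt = x')) ∧
      (∀ j, j ≤ k → ∀ c ∈ bondsOf ((Bj M₁ Z k : DetSet (F.P K)) j), path (embIter j c.src) = [] ∧ path (embIter j c.tgt) = []) ∧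
      (∀ x : Site (F.P K) 0, x ∉ {z : Site (F.P K) 0 | ∃ j, j ≤ k ∧ ∃ c ∈ bondsOf ((Bj M₁ Z k : DetSet (F.P K)) j), (z = embIter j c.src ∨ z = embIter j c.tgt)} →
        ∃ (x' : Site (F.P K) 0) (s : LStep (F.P K) 0), path x = path x' ++ [s] ∧
          (s.fwd = true → s.bond.src = x' ∧ s.bond.tgt = x) ∧ (s.fwd = false → s.bond.src = x ∧ s.bond.tgt = x')) ∧
      (∀ τ, ∀ x, ∀ s ∈ path x, H τ s.bond = 0) ∧
      ∀ τ, fderiv ℝ (msChart F N K k (Bj M₁ Z k) (avgFamily (avOfRecord F N K) (1 : GaugeField (F.P K) 0 (SU N))) (1 : GaugeField (F.P K) 0 (SU N))) 0 (H τ) = τ := by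
  obtain ⟨path, hF1, hF2, htree⟩ := exists_rootedForest_Bj (Z := Z) hk hk1 hM hdiv
  have hroot : ∀ r ∈ {z : Site (F.P K) 0 | ∃ j, j ≤ k ∧ ∃ c ∈ bondsOf ((Bj M₁ Z k : DetSet (F.P K)) j), (z = embIter j c.src ∨ z = embIter j c.tgt)}, path r = [] := by
    rintro r ⟨j, hj, c, hc, rfl | rfl⟩
    · exact (hF2 j hj c hc).1
    · exact (hF2 j hj c hc).2
  obtain ⟨H, hHS, hH⟩ := exists_forest_rightInverse_of_surjective (Bj M₁ Z k) hroot hF1 hsurj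
  exact ⟨path, H, hF1, hF2, htree, hHS, hH⟩

end Record

end Summit.QuantumFields.YangMills.BalabanUVNodes.N12ForestOnto

end
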